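import Mathlib
import HarnessLib

/-!
# Kronecker bits — the half-orbit resolvent and the abstract LEVEL-0 KRONECKER LAW (stub KB2 of the line card
# `kronecker-bits`) for the seed crux `SignedMuSeedAtTwoPlus` stmt-BirchSwinnertonDyer-21438
# (parent Kμ⁺ `SignedMuVanishingAtTwoPlus` stmt-BirchSwinnertonDyer-20689, route ResidualThetaTransportAtTwo)

Cell `bsd-wall`, width seat `bsd-wall-rtt-p4-w2` g16 (`--supports`, closes nothing).  THEOREMS ONLY; BSD is not proved by this.

The crux idea `Cruxes/SignedMuSeedAtTwoPlus/Ideas/kronecker-bits.md` (k1 g26) identifies the level-`0` constant of the tilt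
programme with the reduction of an Eisenstein–Kronecker number.  Its first two steps are finite-sum algebra over an arbitrary finite
abelian group `G` (informally `(𝒪_K/𝔣₀)ˣ`), an element `m` with `m * m = 1`, `m ≠ 1` (informally `-1`), a commutative ring `R` of
values and an ideal `P` (a prime over `2`):

* representatives modulo `⟨m⟩` — the hypothesis `∀ c, (c ∈ Rset ∧ m * c ∉ Rset) ∨ (c ∉ Rset ∧ m * c ∈ Rset)` of the card, kept
  verbatim (no definitions): `not_mem_of_mem_reps`, `mem_of_not_mem_reps`, `mul_ne_self_of_reps`,
  **`sum_reps_eq_sum_reps`** (the sum of an `m`-invariant function over a system of representatives does not depend on the system),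
  `reps_image_mul_left` (`α • Rset` is again a system of representatives), `sum_univ_eq_sum_reps_add` /
  **`sum_univ_eq_two_nsmul_sum_reps`** (full orbit `=` twice the half orbit for invariant summands) and
  **`sum_univ_eq_zero_of_anti`** (anti-invariant summands have full-orbit sum EXACTLY `0` — no division by `2`),
  `exists_reps` / **`exists_canonical_halfSum`** (representatives exist for `m * m = 1`, `m ≠ 1`, so the half-orbit sum of an
  invariant function is ONE canonical value `Λ` with `2 • Λ =` the full-orbit sum — the card's `Λ_e = ½ Σ_G ε̄_e E₁` without `½`);
* the resolvent re-indexing `c ↦ α c`: **`resolvent_reindex_weight`** / `resolvent_reindex` (full orbit, the sketch's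
  `Lines/kronecker_bits.lean` identity `Σ_c ε(c)⁻¹ (a E(αc) − N E(c)) = (a ε(α) − N) Σ_c ε(c)⁻¹ E(c)`) and the EXACT half-orbit
  version **`halfResolvent_reindex_weight`** / `halfResolvent_reindex` for summands invariant under `c ↦ m c`
  (this is the card's remark «no division by 2 is needed because both sides are sums over the same representatives»);
* **`levelZeroKroneckerLaw`** — stub KB2 with the binder list of the sketch's `def LevelZeroKroneckerLaw` VERBATIM: for `E` odd,
  `χ` even, `κ` odd with `κ ≡ 1 (mod P)`, `Gα = a•E(α·) − N•E` and any representatives `Rset`,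
  `Σ_{Rset} χ(c)⁻¹ Gα(c) − (a χ(α) κ(α)⁻¹ − N) · Σ_{Rset} χ(c)⁻¹ κ(c) E(c) ∈ P`; together with `two_mem_of_odd_congr_one`
  (the hypotheses force `2 ∈ P`) and `halfResolvent_chi_kappa` (the exact identity behind it, before reduction).

[folklore]
-/

set_option autoImplicit false
-- the Theorems namespace of this sub repeats the summit name by design (D-0017 nested layout)
set_option linter.dupNamespace false

open Finset

namespace Summit.BirchSwinnertonDyer.BirchSwinnertonDyer.Theorems.SignedMuAtTwo.KroneckerBits

/-! ## Systems of representatives modulo `⟨m⟩` -/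

section Reps

variable {G : Type*} [CommGroup G] {m : G} {Rset Rset' : Finset G}

/-- In a system of representatives modulo `⟨m⟩`, the partner `m * c` of a representative `c` is not a representative. [folklore] -/
theorem not_mem_of_mem_reps (hR : ∀ c, (c ∈ Rset ∧ m * c ∉ Rset) ∨ (c ∉ Rset ∧ m * c ∈ Rset)) {c : G}
    (hc : c ∈ Rset) : m * c ∉ Rset := by
  rcases hR c with h | h
  · exact h.2
  · exact absurd hc h.1

/-- In a system of representatives modulo `⟨m⟩`, the partner `m * c` of a non-representative `c` is a representative. [folklore] -/
theorem mem_of_not_mem_reps (hR : ∀ c, (c ∈ Rset ∧ m * c ∉ Rset) ∨ (c ∉ Rset ∧ m * c ∈ Rset)) {c : G}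
    (hc : c ∉ Rset) : m * c ∈ Rset := by
  rcases hR c with h | h
  · exact absurd h.1 hc
  · exact h.2

/-- If a system of representatives modulo `⟨m⟩` exists then `m` has no fixed point: `m * c ≠ c`. [folklore] -/
theorem mul_ne_self_of_reps (hR : ∀ c, (c ∈ Rset ∧ m * c ∉ Rset) ∨ (c ∉ Rset ∧ m * c ∈ Rset)) (c : G) :
    m * c ≠ c := by
  intro h
  rcases hR c with hc | hc
  · have h1 : m * c ∈ Rset := by rw [h]; exact hc.1
    exact hc.2 h1
  · have h1 : c ∈ Rset := by
      have h2 := hc.2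
      rwa [h] at h2
    exact hc.1 h1

/-- In particular `m ≠ 1` as soon as a system of representatives exists (and `G` is nonempty). [folklore] -/
theorem ne_one_of_reps (hR : ∀ c, (c ∈ Rset ∧ m * c ∉ Rset) ∨ (c ∉ Rset ∧ m * c ∈ Rset)) : m ≠ 1 := by
  intro h
  exact mul_ne_self_of_reps hR 1 (by rw [h, mul_one])

/-- **Independence of the representatives.** For `m * m = 1` and a function `f` invariant under `c ↦ m * c`, the sum of `f`
over a system of representatives modulo `⟨m⟩` does not depend on the system. [folklore] -/
theorem sum_reps_eq_sum_reps {M : Type*} [AddCommMonoid M] (f : G → M) (hf : ∀ c, f (m * c) = f c)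
    (hm : m * m = 1)
    (hR : ∀ c, (c ∈ Rset ∧ m * c ∉ Rset) ∨ (c ∉ Rset ∧ m * c ∈ Rset))
    (hR' : ∀ c, (c ∈ Rset' ∧ m * c ∉ Rset') ∨ (c ∉ Rset' ∧ m * c ∈ Rset')) :
    ∑ c ∈ Rset, f c = ∑ c ∈ Rset', f c := by
  classical
  have hmm : ∀ c : G, m * (m * c) = c := fun c => by rw [← mul_assoc, hm, one_mul]
  refine sum_nbij' (fun c => if c ∈ Rset' then c else m * c) (fun d => if d ∈ Rset then d else m * d)
    ?_ ?_ ?_ ?_ ?_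
  · intro c _
    by_cases h : c ∈ Rset'
    · simp [h]
    · simpa [h] using mem_of_not_mem_reps hR' h
  · intro d _
    by_cases h : d ∈ Rset
    · simp [h]
    · simpa [h] using mem_of_not_mem_reps hR h
  · intro c hc
    by_cases h : c ∈ Rset'
    · simp [h, hc]
    · simp [h, not_mem_of_mem_reps hR hc, hmm]
  · intro d hd
    by_cases h : d ∈ Rset
    · simp [h, hd]
    · simp [h, not_mem_of_mem_reps hR' hd, hmm]
  · intro c _
    by_cases h : c ∈ Rset'
    · simp [h]
    · simp [h, hf]

/-- Membership in the translate `α • Rset`: `d ∈ α • Rset ⟺ α⁻¹ d ∈ Rset`. [folklore] -/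
theorem mem_image_mul_left_iff [DecidableEq G] (α d : G) :
    d ∈ Rset.image (fun c => α * c) ↔ α⁻¹ * d ∈ Rset := by
  rw [mem_image]
  constructor
  · rintro ⟨c, hc, rfl⟩
    rwa [inv_mul_cancel_left]
  · intro h
    exact ⟨α⁻¹ * d, h, by rw [mul_inv_cancel_left]⟩

/-- The translate `α • Rset` of a system of representatives modulo `⟨m⟩` is again one (`G` commutative). [folklore] -/
theorem reps_image_mul_left [DecidableEq G]
    (hR : ∀ c, (c ∈ Rset ∧ m * c ∉ Rset) ∨ (c ∉ Rset ∧ m * c ∈ Rset)) (α d : G) :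
    (d ∈ Rset.image (fun c => α * c) ∧ m * d ∉ Rset.image (fun c => α * c)) ∨
      (d ∉ Rset.image (fun c => α * c) ∧ m * d ∈ Rset.image (fun c => α * c)) := by
  rw [mem_image_mul_left_iff, mem_image_mul_left_iff, mul_left_comm]
  exact hR (α⁻¹ * d)

/-- Summing over the translate `α • Rset` is summing `c ↦ g (α * c)` over `Rset`. [folklore] -/
theorem sum_image_mul_left [DecidableEq G] {M : Type*} [AddCommMonoid M] (g : G → M) (α : G) :
    ∑ d ∈ Rset.image (fun c => α * c), g d = ∑ c ∈ Rset, g (α * c) :=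
  sum_image fun _ _ _ _ h => mul_left_cancel h

/-- The whole group is a system of representatives together with its `m`-translate (disjointly). [folklore] -/
theorem sum_univ_eq_sum_reps_add [Fintype G] {M : Type*} [AddCommMonoid M] (f : G → M) (hm : m * m = 1)
    (hR : ∀ c, (c ∈ Rset ∧ m * c ∉ Rset) ∨ (c ∉ Rset ∧ m * c ∈ Rset)) :
    ∑ c, f c = ∑ c ∈ Rset, f c + ∑ c ∈ Rset, f (m * c) := by
  classical
  have hmm : ∀ c : G, m * (m * c) = c := fun c => by rw [← mul_assoc, hm, one_mul]
  have hdisj : Disjoint Rset (Rset.image (fun c => m * c)) := by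
    rw [disjoint_left]
    intro d hd hd'
    rw [mem_image_mul_left_iff] at hd'
    have h2 := not_mem_of_mem_reps hR hd'
    rw [mul_inv_cancel_left] at h2
    exact h2 hd
  have hcover : Rset ∪ Rset.image (fun c => m * c) = univ := by
    rw [eq_univ_iff_forall]
    intro d
    rw [mem_union, mem_image_mul_left_iff]
    rcases hR d with h | h
    · exact Or.inl h.1
    · refine Or.inr ?_
      have : m⁻¹ = m := inv_eq_of_mul_eq_one_right hm
      rw [this]
      exact h.2
  rw [← hcover, sum_union hdisj, sum_image_mul_left]

/-- **Full orbit `=` twice the half orbit** for an `m`-invariant summand. [folklore] -/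
theorem sum_univ_eq_two_nsmul_sum_reps [Fintype G] {M : Type*} [AddCommMonoid M] (f : G → M)
    (hf : ∀ c, f (m * c) = f c) (hm : m * m = 1)
    (hR : ∀ c, (c ∈ Rset ∧ m * c ∉ Rset) ∨ (c ∉ Rset ∧ m * c ∈ Rset)) :
    ∑ c, f c = 2 • ∑ c ∈ Rset, f c := by
  rw [sum_univ_eq_sum_reps_add f hm hR, two_nsmul]
  congr 1
  exact sum_congr rfl fun c _ => hf c

/-- Ring form of `sum_univ_eq_two_nsmul_sum_reps`: `Σ_G f = 2 * Σ_{Rset} f`. [folklore] -/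
theorem sum_univ_eq_two_mul_sum_reps [Fintype G] {R : Type*} [NonAssocSemiring R] (f : G → R)
    (hf : ∀ c, f (m * c) = f c) (hm : m * m = 1)
    (hR : ∀ c, (c ∈ Rset ∧ m * c ∉ Rset) ∨ (c ∉ Rset ∧ m * c ∈ Rset)) :
    ∑ c, f c = 2 * ∑ c ∈ Rset, f c := by
  rw [sum_univ_eq_two_nsmul_sum_reps f hf hm hR, two_nsmul, two_mul]

/-- **Anti-invariant summands have full-orbit sum exactly zero** (`f (m c) = - f c`; no division by `2`: pair `c` with `m c`).
This is why only ODD characters have a non-trivial resolvent against an odd function. [folklore] -/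
theorem sum_univ_eq_zero_of_anti [Fintype G] {M : Type*} [AddCommGroup M] (f : G → M)
    (hf : ∀ c, f (m * c) = -f c) (hm : m * m = 1)
    (hR : ∀ c, (c ∈ Rset ∧ m * c ∉ Rset) ∨ (c ∉ Rset ∧ m * c ∈ Rset)) :
    ∑ c, f c = 0 := by
  rw [sum_univ_eq_sum_reps_add f hm hR, ← sum_add_distrib]
  exact sum_eq_zero fun c _ => by rw [hf, add_neg_cancel]

/-- **Existence of representatives.** If `m * m = 1` and `m ≠ 1` then a system of representatives modulo `⟨m⟩` exists
(pick from each pair `{c, m c}` the element with the smaller index under any enumeration of `G`). [folklore] -/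
theorem exists_reps [Fintype G] (hm : m * m = 1) (hm1 : m ≠ 1) :
    ∃ Rset : Finset G, ∀ c, (c ∈ Rset ∧ m * c ∉ Rset) ∨ (c ∉ Rset ∧ m * c ∈ Rset) := by
  classical
  let e := Fintype.equivFin G
  refine ⟨univ.filter (fun c => e c < e (m * c)), fun c => ?_⟩
  have hmm : m * (m * c) = c := by rw [← mul_assoc, hm, one_mul]
  have hne : e (m * c) ≠ e c := by
    intro h
    exact hm1 (mul_right_cancel ((e.injective h).trans (one_mul c).symm))
  simp only [mem_filter, mem_univ, true_and, hmm]
  rcases lt_or_gt_of_ne hne with h | h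
  · exact Or.inr ⟨not_lt.mpr h.le, h⟩
  · exact Or.inl ⟨h, not_lt.mpr h.le⟩

/-- **The half-orbit sum is canonical**: for `m * m = 1`, `m ≠ 1` and an `m`-invariant `f` there is ONE value `Λ` which is the
sum of `f` over EVERY system of representatives modulo `⟨m⟩`, and `2 • Λ` is the full-orbit sum (informally: the resolvent
`Λ_e = ½ Σ_G ε̄_e E₁` of the card is a well-defined half-orbit sum, no division by `2`). [folklore] -/
theorem exists_canonical_halfSum [Fintype G] {M : Type*} [AddCommMonoid M] (f : G → M) (hf : ∀ c, f (m * c) = f c)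
    (hm : m * m = 1) (hm1 : m ≠ 1) :
    ∃ Λ : M, 2 • Λ = ∑ c, f c ∧
      ∀ Rset : Finset G, (∀ c, (c ∈ Rset ∧ m * c ∉ Rset) ∨ (c ∉ Rset ∧ m * c ∈ Rset)) → ∑ c ∈ Rset, f c = Λ := by
  obtain ⟨R₀, hR₀⟩ := exists_reps hm hm1
  exact ⟨∑ c ∈ R₀, f c, (sum_univ_eq_two_nsmul_sum_reps f hf hm hR₀).symm,
    fun Rset hR => sum_reps_eq_sum_reps f hf hm hR hR₀⟩

end Reps

/-! ## The resolvent re-indexing `c ↦ α c` -/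

section Resolvent

variable {G R : Type*} [CommGroup G] [CommRing R]

/-- **Full-orbit resolvent re-indexing, weight form.** For a weight `w` with `w c = u * w (α c)` (a character twist) and any
orbit function `E`: `Σ_c w(c)·(a E(αc) − N E(c)) = (a u − N)·Σ_c w(c) E(c)`. [folklore] -/
theorem resolvent_reindex_weight [Fintype G] (E w : G → R) (α : G) (u a N : R) (hw : ∀ c, w c = u * w (α * c)) :
    ∑ c, w c * (a * E (α * c) - N * E c) = (a * u - N) * ∑ c, w c * E c := by
  have h1 : ∑ c, w c * E (α * c) = u * ∑ c, w c * E c := by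
    calc ∑ c, w c * E (α * c) = ∑ c, u * (w (α * c) * E (α * c)) :=
          Fintype.sum_congr _ _ fun c => by rw [hw c, mul_assoc]
      _ = u * ∑ c, w (α * c) * E (α * c) := by rw [mul_sum]
      _ = u * ∑ c, w c * E c := by
          congr 1
          exact Fintype.sum_equiv (Equiv.mulLeft α) _ _ fun c => rfl
  have h2 : ∑ c, w c * (a * E (α * c) - N * E c) = a * ∑ c, w c * E (α * c) - N * ∑ c, w c * E c := by
    rw [mul_sum, mul_sum, ← sum_sub_distrib]
    exact sum_congr rfl fun c _ => by ring
  rw [h2, h1]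
  ring

/-- The character weight `c ↦ ε(c)⁻¹` is a twist weight with `u = ε(α)`. [folklore] -/
theorem inv_char_weight (ε : G →* Rˣ) (α c : G) :
    (((ε c)⁻¹ : Rˣ) : R) = (ε α : R) * (((ε (α * c))⁻¹ : Rˣ) : R) := by
  have h : (ε α : R) * (((ε α)⁻¹ : Rˣ) : R) = 1 := Units.mul_inv _
  calc (((ε c)⁻¹ : Rˣ) : R) = (((ε c)⁻¹ : Rˣ) : R) * ((ε α : R) * (((ε α)⁻¹ : Rˣ) : R)) := by rw [h, mul_one]
    _ = (ε α : R) * ((((ε c)⁻¹ : Rˣ) : R) * (((ε α)⁻¹ : Rˣ) : R)) := by ring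
    _ = (ε α : R) * (((ε (α * c))⁻¹ : Rˣ) : R) := by rw [map_mul, mul_inv_rev, Units.val_mul]

/-- **Full-orbit resolvent re-indexing** (the sketch `Lines/kronecker_bits.lean`'s `resolvent_reindex`, step (iv) of T0; informally
`E c = E₁(cΩ/f₀; Ω𝒪_K)`, `a = α`, `N = Nα`): `Σ_c ε(c)⁻¹ (a E(αc) − N E(c)) = (a ε(α) − N) Σ_c ε(c)⁻¹ E(c)`. [folklore] -/
theorem resolvent_reindex [Fintype G] (E : G → R) (ε : G →* Rˣ) (α : G) (a N : R) :
    ∑ c, (((ε c)⁻¹ : Rˣ) : R) * (a * E (α * c) - N * E c)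
      = (a * (ε α : R) - N) * ∑ c, (((ε c)⁻¹ : Rˣ) : R) * E c :=
  resolvent_reindex_weight E (fun c => (((ε c)⁻¹ : Rˣ) : R)) α (ε α : R) a N (inv_char_weight ε α)

variable {m : G} {Rset : Finset G}

/-- **Half-orbit resolvent re-indexing, weight form (EXACT).** If `m * m = 1`, the weighted summand `w·E` is invariant under
`c ↦ m c` and `w c = u * w (α c)`, then over ANY system of representatives modulo `⟨m⟩`:
`Σ_{Rset} w(c)·(a E(αc) − N E(c)) = (a u − N)·Σ_{Rset} w(c) E(c)` — no division by `2`. [folklore] -/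
theorem halfResolvent_reindex_weight [DecidableEq G] (E w : G → R) (α : G) (u a N : R)
    (hw : ∀ c, w c = u * w (α * c)) (hinv : ∀ c, w (m * c) * E (m * c) = w c * E c) (hm : m * m = 1)
    (hR : ∀ c, (c ∈ Rset ∧ m * c ∉ Rset) ∨ (c ∉ Rset ∧ m * c ∈ Rset)) :
    ∑ c ∈ Rset, w c * (a * E (α * c) - N * E c) = (a * u - N) * ∑ c ∈ Rset, w c * E c := by
  have h1 : ∑ c ∈ Rset, w c * E (α * c) = u * ∑ c ∈ Rset, w c * E c := by
    calc ∑ c ∈ Rset, w c * E (α * c) = ∑ c ∈ Rset, u * (w (α * c) * E (α * c)) :=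
          sum_congr rfl fun c _ => by rw [hw c, mul_assoc]
      _ = u * ∑ c ∈ Rset, w (α * c) * E (α * c) := by rw [mul_sum]
      _ = u * ∑ d ∈ Rset.image (fun c => α * c), w d * E d := by
          rw [sum_image_mul_left (fun d => w d * E d)]
      _ = u * ∑ c ∈ Rset, w c * E c := by
          rw [sum_reps_eq_sum_reps (fun d => w d * E d) hinv hm (reps_image_mul_left hR α) hR]
  have h2 : ∑ c ∈ Rset, w c * (a * E (α * c) - N * E c)
      = a * ∑ c ∈ Rset, w c * E (α * c) - N * ∑ c ∈ Rset, w c * E c := by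
    rw [mul_sum, mul_sum, ← sum_sub_distrib]
    exact sum_congr rfl fun c _ => by ring
  rw [h2, h1]
  ring

/-- **Half-orbit resolvent re-indexing** for a character `ε` with `ε(c)⁻¹ E(c)` invariant under `c ↦ m c` (e.g. `E` odd and
`ε` odd): `Σ_{Rset} ε(c)⁻¹ (a E(αc) − N E(c)) = (a ε(α) − N) Σ_{Rset} ε(c)⁻¹ E(c)`, exactly. [folklore] -/
theorem halfResolvent_reindex [DecidableEq G] (E : G → R) (ε : G →* Rˣ) (α : G) (a N : R)
    (hinv : ∀ c, (((ε (m * c))⁻¹ : Rˣ) : R) * E (m * c) = (((ε c)⁻¹ : Rˣ) : R) * E c) (hm : m * m = 1)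
    (hR : ∀ c, (c ∈ Rset ∧ m * c ∉ Rset) ∨ (c ∉ Rset ∧ m * c ∈ Rset)) :
    ∑ c ∈ Rset, (((ε c)⁻¹ : Rˣ) : R) * (a * E (α * c) - N * E c)
      = (a * (ε α : R) - N) * ∑ c ∈ Rset, (((ε c)⁻¹ : Rˣ) : R) * E c :=
  halfResolvent_reindex_weight E (fun c => (((ε c)⁻¹ : Rˣ) : R)) α (ε α : R) a N (inv_char_weight ε α) hinv hm hR

/-- For `E` odd and `ε` odd (`ε m = -1`) the summand `ε(c)⁻¹ E(c)` is invariant under `c ↦ m c`. [folklore] -/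
theorem inv_char_mul_invariant (E : G → R) (ε : G →* Rˣ) (hE : ∀ c, E (m * c) = -E c) (hε : ε m = -1) (c : G) :
    (((ε (m * c))⁻¹ : Rˣ) : R) * E (m * c) = (((ε c)⁻¹ : Rˣ) : R) * E c := by
  rw [map_mul, hε, mul_inv_rev, inv_neg, inv_one, Units.val_mul, Units.val_neg, Units.val_one, hE]
  ring

end Resolvent

/-! ## The level-`0` Kronecker law (stub KB2) -/

section LevelZero

variable {G R : Type*} [CommGroup G] [CommRing R]

/-- The hypotheses «`κ` odd» and «`κ ≡ 1 (mod P)`» force `2 ∈ P`: the law lives over a prime above `2`. [folklore] -/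
theorem two_mem_of_odd_congr_one (P : Ideal R) {m : G} (κ : G →* Rˣ) (hκ : κ m = -1)
    (hκP : ∀ c, (κ c : R) - 1 ∈ P) : (2 : R) ∈ P := by
  have h := hκP m
  rw [hκ, Units.val_neg, Units.val_one] at h
  have h2 : (2 : R) = -((-1 : R) - 1) := by ring
  rw [h2]
  exact P.neg_mem h

/-- The weight `c ↦ χ(c)⁻¹ κ(c)` (i.e. `ε⁻¹` for `ε = χ κ⁻¹`) is a twist weight with `u = χ(α) κ(α)⁻¹`. [folklore] -/
theorem chi_kappa_weight (χ κ : G →* Rˣ) (α c : G) :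
    (((χ c)⁻¹ : Rˣ) : R) * (κ c : R)
      = ((χ α : R) * (((κ α)⁻¹ : Rˣ) : R)) * ((((χ (α * c))⁻¹ : Rˣ) : R) * (κ (α * c) : R)) := by
  have h1 : (χ α : R) * (((χ α)⁻¹ : Rˣ) : R) = 1 := Units.mul_inv _
  have h2 : (((κ α)⁻¹ : Rˣ) : R) * (κ α : R) = 1 := Units.inv_mul _
  rw [map_mul, map_mul, mul_inv_rev, Units.val_mul, Units.val_mul]
  linear_combination (-((((χ c)⁻¹ : Rˣ) : R) * (κ c : R) * ((((κ α)⁻¹ : Rˣ) : R) * (κ α : R)))) * h1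
    + (-((((χ c)⁻¹ : Rˣ) : R) * (κ c : R))) * h2

/-- For `E` odd, `χ` even and `κ` odd the summand `χ(c)⁻¹ κ(c) E(c)` is invariant under `c ↦ m c`. [folklore] -/
theorem chi_kappa_mul_invariant {m : G} (E : G → R) (χ κ : G →* Rˣ) (hE : ∀ c, E (m * c) = -E c)
    (hχ : χ m = 1) (hκ : κ m = -1) (c : G) :
    (((χ (m * c))⁻¹ : Rˣ) : R) * (κ (m * c) : R) * E (m * c) = (((χ c)⁻¹ : Rˣ) : R) * (κ c : R) * E c := by
  rw [map_mul, map_mul, hχ, hκ, one_mul, Units.val_mul, Units.val_neg, Units.val_one, hE]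
  ring

/-- **The exact identity behind KB2** (characteristic `0`, before reduction): for `E` odd, `χ` even, `κ` odd and
`Gα = a•E(α·) − N•E`, over any system of representatives modulo `⟨m⟩`,
`Σ_{Rset} χ(c)⁻¹κ(c) Gα(c) = (a χ(α)κ(α)⁻¹ − N) · Σ_{Rset} χ(c)⁻¹κ(c) E(c)` — the twisted half-orbit functional IS the smoothing
factor times the half resolvent `Λ` of the odd character `χκ⁻¹`. [folklore] -/
theorem halfResolvent_chi_kappa [DecidableEq G] {m : G} (E Gα : G → R) (χ κ : G →* Rˣ) (α : G) (a N : R)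
    (Rset : Finset G) (hm : m * m = 1) (hE : ∀ c, E (m * c) = -E c) (hχ : χ m = 1) (hκ : κ m = -1)
    (hG : ∀ c, Gα c = a * E (α * c) - N * E c)
    (hR : ∀ c, (c ∈ Rset ∧ m * c ∉ Rset) ∨ (c ∉ Rset ∧ m * c ∈ Rset)) :
    ∑ c ∈ Rset, (((χ c)⁻¹ : Rˣ) : R) * (κ c : R) * Gα c
      = (a * (χ α : R) * (((κ α)⁻¹ : Rˣ) : R) - N)
          * ∑ c ∈ Rset, (((χ c)⁻¹ : Rˣ) : R) * (κ c : R) * E c := by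
  have key := halfResolvent_reindex_weight E (fun c => (((χ c)⁻¹ : Rˣ) : R) * (κ c : R)) α
    ((χ α : R) * (((κ α)⁻¹ : Rˣ) : R)) a N (chi_kappa_weight χ κ α)
    (chi_kappa_mul_invariant E χ κ hE hχ hκ) hm hR
  simp only [hG]
  rw [key, mul_assoc a]

/-- **LEVEL-0 KRONECKER LAW** (stub KB2 of `Cruxes/SignedMuSeedAtTwoPlus/Lines/kronecker-bits.md`; the binder list is that of the
sketch's `def LevelZeroKroneckerLaw` verbatim).  Informally `E c = E₁(cΩ/f₀; Ω𝒪_K)`, `G = (𝒪_K/f₀)ˣ`, `m = -1`, `P` a prime over `2`,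
`χ = χ₀^e` even, `κ` an odd character of `2`-power order (so `κ ≡ 1 mod P`), `Gα c = (d/dz) log ψ_α (x(P_c)) = a E(αc) − N E(c)`:
the half-orbit functional `Σ_{Rset} χ(c)⁻¹ Gα(c)` is congruent modulo `P` to `(a χ(α) κ(α)⁻¹ − N) · Σ_{Rset} χ(c)⁻¹ κ(c) E(c)` for
EVERY system of representatives `Rset` modulo `⟨m⟩`.  Proof: `κ ≡ 1` termwise, then the exact `halfResolvent_chi_kappa`;
the hypothesis `m ≠ 1` is not needed (it follows from the existence of `Rset`, `ne_one_of_reps`). [folklore] -/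
theorem levelZeroKroneckerLaw (G R : Type) [CommGroup G] [Fintype G] [DecidableEq G] [CommRing R]
    (P : Ideal R) (m : G) (E Gα : G → R) (χ κ : G →* Rˣ) (α : G) (a N : R) (Rset : Finset G)
    (hm : m * m = 1) (_hm1 : m ≠ 1)
    (hE : ∀ c, E (m * c) = - E c)
    (hχ : χ m = 1) (hκ : κ m = -1) (hκP : ∀ c, (κ c).val - 1 ∈ P)
    (hG : ∀ c, Gα c = a * E (α * c) - N * E c)
    (hR : ∀ c, (c ∈ Rset ∧ m * c ∉ Rset) ∨ (c ∉ Rset ∧ m * c ∈ Rset)) :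
    (∑ c ∈ Rset, ((χ c)⁻¹ : Rˣ).val * Gα c)
      - (a * (χ α).val * ((κ α)⁻¹ : Rˣ).val - N)
        * (∑ c ∈ Rset, ((χ c)⁻¹ : Rˣ).val * (κ c).val * E c) ∈ P := by
  have hexact := halfResolvent_chi_kappa E Gα χ κ α a N Rset hm hE hχ hκ hG hR
  have hdiff : (∑ c ∈ Rset, ((χ c)⁻¹ : Rˣ).val * Gα c)
      - ∑ c ∈ Rset, (((χ c)⁻¹ : Rˣ) : R) * (κ c : R) * Gα c ∈ P := by
    rw [← sum_sub_distrib]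
    refine P.sum_mem fun c _ => ?_
    have h := P.mul_mem_left (-((((χ c)⁻¹ : Rˣ) : R) * Gα c)) (hκP c)
    convert h using 1
    ring
  have hrw : (∑ c ∈ Rset, ((χ c)⁻¹ : Rˣ).val * Gα c)
      - (a * (χ α).val * ((κ α)⁻¹ : Rˣ).val - N) * (∑ c ∈ Rset, ((χ c)⁻¹ : Rˣ).val * (κ c).val * E c)
      = (∑ c ∈ Rset, ((χ c)⁻¹ : Rˣ).val * Gα c) - ∑ c ∈ Rset, (((χ c)⁻¹ : Rˣ) : R) * (κ c : R) * Gα c := by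
    rw [hexact]
  rw [hrw]
  exact hdiff

/-- `levelZeroKroneckerLaw` in the universally quantified shape of the sketch's `def LevelZeroKroneckerLaw : Prop`
(`Cruxes/SignedMuSeedAtTwoPlus/Lines/kronecker_bits.lean`), so that a line file can discharge that `def` by `exact`. [folklore] -/
theorem levelZeroKroneckerLaw_forall :
    ∀ (G R : Type) [CommGroup G] [Fintype G] [DecidableEq G] [CommRing R]
      (P : Ideal R) (m : G) (E Gα : G → R) (χ κ : G →* Rˣ) (α : G) (a N : R) (Rset : Finset G),
      m * m = 1 → m ≠ 1 →
      (∀ c, E (m * c) = - E c) →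
      χ m = 1 → κ m = -1 → (∀ c, (κ c).val - 1 ∈ P) →
      (∀ c, Gα c = a * E (α * c) - N * E c) →
      (∀ c, (c ∈ Rset ∧ m * c ∉ Rset) ∨ (c ∉ Rset ∧ m * c ∈ Rset)) →
      (∑ c ∈ Rset, ((χ c)⁻¹ : Rˣ).val * Gα c)
        - (a * (χ α).val * ((κ α)⁻¹ : Rˣ).val - N)
          * (∑ c ∈ Rset, ((χ c)⁻¹ : Rˣ).val * (κ c).val * E c) ∈ P :=
  levelZeroKroneckerLaw

end LevelZero

end Summit.BirchSwinnertonDyer.BirchSwinnertonDyer.Theorems.SignedMuAtTwo.KroneckerBits
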